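import Summits.ABC.IUTFork.Joshi.ArithTeichmullerAction
import HarnessLib

/-!
# Joshi, *Arithmetic Teichmüller spaces I* — `|𝒳_{F,E}| = |𝒴_{F,E}|/φ^ℤ` and [J-I] Thm (th:main3) (4) (v4 Thm 5.21.1 (4)):
# the induced map on Frobenius orbits, with its well-definedness condition made explicit

Record/proof file of the abc-iut cell, branch E (seat abc-iut-E-t1; rung LADDER-ABC:A2.E); closes the gap left in
`ArithTeichmullerAction` (p429850), whose `UntiltPoints.ptAct` types item (3) of Thm (th:main3) = v4 Thm 5.21.1 only.
TAKES NO SIDE on [IUTchIII] Cor. 3.12 or on any author; typed ≠ proved ≠ endorsed.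
Source: K. Joshi, arXiv 2106.11452, 2021 corpus-TeX render §8 Thm (th:main3) (4), chunk p0021 = **v4 (version of
record) Thm 5.21.1 (4), p.34 l.28–31**: «Let `y ∈ 𝒴_{F,E}` be a closed point of degree one. Then one has an action of
`Aut_{𝒪_E}(𝒢(𝒪_F))` on closed points of degree one of `𝒳_{F,E}` via mapping `{φⁿ(y) : n ∈ ℤ} ↦ {φⁿ(σ(y)) : n ∈ ℤ}`»,
together with «one has a canonical identification `|𝒴_{F,E}|/φ^ℤ ≃ |𝒳_{F,E}|` given by `y ↦ {φⁿ(y) : n ∈ ℤ}`» (chunk p0021;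
v4 §5.1x) [FarguesFontaine2018]. [claim: Joshi2021ATS1, status: disputed]

WHAT IS TYPED / PROVED.
* `frobRel`, `XPt D` — the Frobenius-orbit relation on `|𝒴_{F,E}|` and the quotient `|𝒳_{F,E}| := |𝒴_{F,E}|/φ^ℤ` (DEFINED
  from the signature's `frob`), `xClass : |𝒴| → |𝒳|`.
* `xActRep σ : |𝒴| → |𝒳|`, `y ↦ [σ(y)]` — item (4) EXACTLY AS PRINTED: a map defined on the representative `y`.
* `FrobCompatible σ` — the condition under which the printed recipe is a well-defined map `|𝒳| → |𝒳|` (the class of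
  `σ(φ(y))` is the class of `σ(y)`); print does not state it (it holds for the Fargues–Fontaine curve because `σ` is
  additive and `φ` acts on `𝒢(𝒪_F)` compatibly — a property of objects not typed here). Under it: `xAct σ : |𝒳| → |𝒳|`
  (DEFINED by `Quotient.lift`, `xAct_xClass`). Named `Prop`, never asserted.
* `untilt_topIso_of_frobRel` — under the named Prop `FrobPreservesUntilt` of `ArithTeichmullerAction` (`K_{φ(y)} ≅ K_y`),
  points in one Frobenius orbit have topologically isomorphic residue fields: the closed points of `𝒳_{F,E}`
  parametrise untilts UP TO ISOMORPHISM (PROVED from the hypothesis, by induction over `ℤ`).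
Deliberately NOT here: any property of the actual Fargues–Fontaine curve (no such object in the tree).
-/

noncomputable section

namespace Summit.ABC.IUTFork.Joshi

namespace UntiltPoints

variable {p : ℕ} [Fact p.Prime] {𝒪E : Type} [CommRing 𝒪E] (D : UntiltPoints p 𝒪E)

/-! ## 1. `|𝒳_{F,E}| = |𝒴_{F,E}|/φ^ℤ` -/

/-- The Frobenius-orbit relation on the degree-one points: `y ~ y′` iff `y′ = φⁿ(y)` for some `n ∈ ℤ` («`{φⁿ(y) : n ∈ ℤ}`»,
chunk p0021). [claim: Joshi2021ATS1, status: disputed] -/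
def frobRel : Setoid D.Pt where
  r y y' := ∃ n : ℤ, (D.frob ^ n) y = y'
  iseqv :=
    { refl := fun y => ⟨0, by simp⟩
      symm := fun {y y'} h => by
        obtain ⟨n, hn⟩ := h
        refine ⟨-n, ?_⟩
        rw [← hn, ← Equiv.Perm.mul_apply, zpow_neg, inv_mul_cancel, Equiv.Perm.one_apply]
      trans := fun {a b c} h h' => by
        obtain ⟨n, hn⟩ := h
        obtain ⟨m, hm⟩ := h'
        refine ⟨m + n, ?_⟩
        rw [zpow_add, Equiv.Perm.mul_apply, hn, hm] }

/-- **`|𝒳_{F,E}|`**: the closed points of degree one of the Fargues–Fontaine curve `𝒳_{F,E}` as the quotient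
`|𝒴_{F,E}|/φ^ℤ` («one has a canonical identification `|𝒴_{F,E}|/φ^ℤ ≃ |𝒳_{F,E}|`», chunk p0021 [FarguesFontaine2018]).
[claim: Joshi2021ATS1, status: disputed] -/
def XPt : Type := Quotient D.frobRel

/-- The class `{φⁿ(y) : n ∈ ℤ}` of a point. [claim: Joshi2021ATS1, status: disputed] -/
def xClass (y : D.Pt) : D.XPt := Quotient.mk D.frobRel y

/-- `xClass` is onto. [folklore] -/
theorem xClass_surjective : Function.Surjective D.xClass := Quotient.mk_surjective

/-- `φ(y)` and `y` have the same class. [folklore] -/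
theorem xClass_frob (y : D.Pt) : D.xClass (D.frob y) = D.xClass y :=
  Quotient.sound ⟨-1, by simp⟩

/-- Two points have the same class iff they lie in one Frobenius orbit. [folklore] -/
theorem xClass_eq_iff (y y' : D.Pt) : D.xClass y = D.xClass y' ↔ ∃ n : ℤ, (D.frob ^ n) y = y' :=
  Quotient.eq (r := D.frobRel)

/-! ## 2. Thm (th:main3) (4) = v4 Thm 5.21.1 (4): the induced map, as printed and when well defined -/

/-- **Item (4) AS PRINTED**: «`{φⁿ(y) : n ∈ ℤ} ↦ {φⁿ(σ(y)) : n ∈ ℤ}`» — a map from POINTS `y` to classes, i.e. defined on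
the representative (chunk p0021; v4 p.34 l.28–31). [claim: Joshi2021ATS1, status: disputed] -/
def xActRep (σ : D.Aut) (y : D.Pt) : D.XPt := D.xClass (D.ptAct σ y)

/-- The WELL-DEFINEDNESS CONDITION of item (4) (implicit in print): replacing the representative `y` by `φ(y)` does
not change the class of `σ(y)`. Named `Prop`, never asserted (for the Fargues–Fontaine curve it reflects the
compatibility of `σ` with the Frobenius on `𝒢(𝒪_F)`, an object not typed here). [claim: Joshi2021ATS1, status: disputed] -/
@[claim "Joshi2021ATS1" "disputed"]
def FrobCompatible (σ : D.Aut) : Prop := ∀ y : D.Pt, D.xClass (D.ptAct σ (D.frob y)) = D.xClass (D.ptAct σ y)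

/-- Under `FrobCompatible σ`, all points of a Frobenius orbit are sent to one class (induction over `ℤ`). [folklore] -/
theorem xActRep_eq_of_frobRel {σ : D.Aut} (h : D.FrobCompatible σ) {y y' : D.Pt} (hyy' : D.frobRel.r y y') :
    D.xActRep σ y = D.xActRep σ y' := by
  -- one step and its inverse
  have step : ∀ z : D.Pt, D.xActRep σ (D.frob z) = D.xActRep σ z := fun z => h z
  have stepInv : ∀ z : D.Pt, D.xActRep σ (D.frob.symm z) = D.xActRep σ z := fun z => by
    have := step (D.frob.symm z)
    rw [Equiv.apply_symm_apply] at this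
    exact this.symm
  -- all natural powers, of `φ` and of `φ⁻¹`
  have powNat : ∀ (k : ℕ) (z : D.Pt), D.xActRep σ ((D.frob ^ k) z) = D.xActRep σ z := by
    intro k
    induction k with
    | zero => intro z; simp
    | succ k ih => intro z; rw [pow_succ', Equiv.Perm.mul_apply, step, ih]
  have powNatInv : ∀ (k : ℕ) (z : D.Pt), D.xActRep σ ((D.frob.symm ^ k) z) = D.xActRep σ z := by
    intro k
    induction k with
    | zero => intro z; simp
    | succ k ih => intro z; rw [pow_succ', Equiv.Perm.mul_apply, stepInv, ih]
  obtain ⟨n, rfl⟩ := hyy'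
  cases n with
  | ofNat k => rw [Int.ofNat_eq_natCast, zpow_natCast, powNat]
  | negSucc k => rw [zpow_negSucc, ← inv_pow, Equiv.Perm.inv_def, powNatInv]

/-- **Item (4) as a map `|𝒳_{F,E}| → |𝒳_{F,E}|`**, DEFINED under the well-definedness condition. [claim: Joshi2021ATS1, status: disputed] -/
def xAct (σ : D.Aut) (h : D.FrobCompatible σ) : D.XPt → D.XPt :=
  Quotient.lift (D.xActRep σ) fun _ _ hyy' => D.xActRep_eq_of_frobRel h hyy'

/-- `xAct σ` sends the class of `y` to the class of `σ(y)` — the printed recipe. [folklore] -/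
theorem xAct_xClass (σ : D.Aut) (h : D.FrobCompatible σ) (y : D.Pt) :
    D.xAct σ h (D.xClass y) = D.xClass (D.ptAct σ y) := rfl

/-- The identity is Frobenius-compatible … [folklore] -/
theorem frobCompatible_one : D.FrobCompatible 1 := fun y => by
  rw [D.ptAct_one, D.ptAct_one, D.xClass_frob]

/-- … and acts trivially on `|𝒳_{F,E}|`. [folklore] -/
theorem xAct_one (x : D.XPt) : D.xAct 1 D.frobCompatible_one x = x := by
  obtain ⟨y, rfl⟩ := D.xClass_surjective x
  rw [xAct_xClass, D.ptAct_one]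

/-! ## 3. Frobenius orbits parametrise untilts up to isomorphism (under `FrobPreservesUntilt`) -/

/-- Under `FrobPreservesUntilt` (`K_{φ(y)} ≅ K_y` topologically, [FarguesFontaine2018] — a named `Prop` of
`ArithTeichmullerAction`, assumed here as a hypothesis), two points in one Frobenius orbit have topologically
isomorphic residue fields: the closed points of `𝒳_{F,E}` parametrise the untilts up to isomorphism (chunk p0021:
untilts «are parametrized by Fargues–Fontaine curves»). PROVED from the hypothesis by induction over `ℤ`. [folklore] -/
theorem untilt_topIso_of_frobRel (hF : D.FrobPreservesUntilt) {y y' : D.Pt} (h : D.frobRel.r y y') :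
    (D.untilt y).TopIso (D.untilt y') := by
  have step : ∀ z : D.Pt, (D.untilt (D.frob z)).TopIso (D.untilt z) := hF
  have stepInv : ∀ z : D.Pt, (D.untilt (D.frob.symm z)).TopIso (D.untilt z) := fun z => by
    have := step (D.frob.symm z)
    rw [Equiv.apply_symm_apply] at this
    exact this.symm
  have powNat : ∀ (k : ℕ) (z : D.Pt), (D.untilt ((D.frob ^ k) z)).TopIso (D.untilt z) := by
    intro k
    induction k with
    | zero => intro z; simpa using Untilt.TopIso.refl _
    | succ k ih =>
        intro z
        rw [pow_succ', Equiv.Perm.mul_apply]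
        exact (step _).trans (ih z)
  have powNatInv : ∀ (k : ℕ) (z : D.Pt), (D.untilt ((D.frob.symm ^ k) z)).TopIso (D.untilt z) := by
    intro k
    induction k with
    | zero => intro z; simpa using Untilt.TopIso.refl _
    | succ k ih =>
        intro z
        rw [pow_succ', Equiv.Perm.mul_apply]
        exact (stepInv _).trans (ih z)
  obtain ⟨n, rfl⟩ := h
  cases n with
  | ofNat k => rw [Int.ofNat_eq_natCast, zpow_natCast]; exact (powNat k y).symm
  | negSucc k => rw [zpow_negSucc, ← inv_pow, Equiv.Perm.inv_def]; exact (powNatInv (k + 1) y).symm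

/-- Hence, under `FrobPreservesUntilt`, the residue field is well defined on `|𝒳_{F,E}|` up to topological
isomorphism: equal classes ⇒ isomorphic untilts. [folklore] -/
theorem untilt_topIso_of_xClass_eq (hF : D.FrobPreservesUntilt) {y y' : D.Pt} (h : D.xClass y = D.xClass y') :
    (D.untilt y).TopIso (D.untilt y') :=
  D.untilt_topIso_of_frobRel hF ((D.xClass_eq_iff y y').1 h)

end UntiltPoints

end Summit.ABC.IUTFork.Joshi

end
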